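import Literature.NumberTheory.Automorphic.ModulusInvariantIntegral
import Literature.NumberTheory.Automorphic.GLnLocalUnimodular
import Literature.NumberTheory.Automorphic.TateLocalZetaShells
import Literature.NumberTheory.Automorphic.InducedWhittakerVanishing
import Literature.NumberTheory.Automorphic.Liu2021.LemD1SplitPlaceOfFacts
import Literature.RepresentationTheory.Unitary.AdmissibleUnitarySemisimple
import HarnessLib

/-!
# Unitary parabolic induction on `GL_N(F)` is completely reducible

Topic `NumberTheory/Automorphic`; namespace `Literature.NumberTheory.Automorphic` (the corollary for the
inducing datum of [Zelevinsky1980, Thm. 4.2] in the grouping sub-namespace `Zelevinsky1980`). KERNEL ONLY: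
theorems, 0 definitions, 0 named facts, 0 `sorry`.

Let `F` be a non-archimedean local field, `c : Fin N → α` a block labelling with standard parabolic
`P_c = M_c U_c ≤ GL_N(F)` (`standardParabolicGL`), and `χ : M_c → ℂˣ` a character of the standard Levi
`Π_a GL_{n_a}(F)` which is UNITARY (`‖χ‖ = 1`) and SMOOTH (open kernel). The normalised induced
representation `i_c(𝟙 ⊗ χ) = Ind_{P_c}^{GL_N(F)}(χ ∘ proj ⊗ δ_{P_c}^{1/2})` is the tree's
`Representation.parabolicIndGL F c ((Representation.trivial ℂ _ ℂ).twist χ)` (`ParabolicGL`), realised on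
locally constant functions `f : GL_N(F) → ℂ` with `f(p x) = δ_{P_c}^{1/2}(p) χ(proj p) f(x)`
(`toFun_parabolicIndGL_twist_mul`).

* `conj_mul_toFun_parabolicIndGL_mul` — for `f₁, f₂ ∈ i_c(𝟙 ⊗ χ)` the function `conj f₁ · f₂` lies in
  the induced space of the modular character: `(conj f₁ · f₂)(p x) = Δ_{P_c}(p) (conj f₁ · f₂)(x)`, because
  `(δ_{P_c}^{1/2})² = δ_{P_c}` IS Mathlib's `modularCharacter` of `↥P_c` (the tree's `rootDeltaChar`,
  `JacquetModule`) and `|χ| = 1` (Cartier: «for `χ` unitary and `f₁, f₂` in `I(χ)` the function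
  `f̄₁ f₂` belongs to `I(δ^{1/2})`»);
* **`isSemisimpleRepresentation_parabolicIndGL_twist`** — `i_c(𝟙 ⊗ χ)` is a semisimple representation
  (Mathlib `Representation.IsSemisimpleRepresentation`: every subrepresentation has an invariant
  complement). Proof (Cartier 1979, Thm. 3.2 (c) with (9)–(11)): with `K₀ ≤ GL_N(F)` compact open and
  `GL_N(F) = P_c K₀` (Iwasawa, `exists_isCompact_isOpen_forall_standardParabolicGL_mul`), the form
  `(f₁ | f₂) = ∫_{K₀} conj f₁(k) f₂(k) dμ_{K₀}` is positive definite Hermitian (a function of `i_c` vanishing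
  on `K₀` vanishes), and `GL_N(F)`-invariant because the `K₀`-integral on `Ind(Δ_{P_c})` is the invariant
  linear form `J` («`J(P_{δ^{1/2}} f) = ∫_G f(g) dg`»): the tree's `integral_subgroup_comp_mul_right_eq`
  (`ModulusInvariantIntegral`, from the `G = HK` integration formula `HaarHK.eq_smul_map_prod` and the
  unimodularity of `GL_N(F)`, `GLn.isMulRightInvariant_of_isHaarMeasure_local`). An admissible
  (`Representation.isAdmissible_parabolicIndGL_holds`) representation with an invariant positive definite
  Hermitian form on a group with a compact open subgroup is completely reducible
  (`RepresentationTheory.Unitary.isSemisimpleRepresentation_of_isAdmissible`, Bump 1997 Prop. 4.2.5);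
* `Zelevinsky1980.isSemisimpleRepresentation_parabolicIndGL_detChar` — the case of the maximal parabolic
  `Q_{N-1,1}` and the Levi character `(ν₀ ∘ det) ⊠ χ′` of [Zelevinsky1980, §3.2 / Thm. 4.2] for unitary
  continuous `ν₀, χ′ : Fˣ → ℂˣ` (`Zelevinsky1980.maxParabolicLeviChar`, file
  `ParabolicIndGLDetCharIrreducible`): the complete-reducibility half of the named fact
  `Zelevinsky1980.parabolicIndGL_detChar_unitary_isIrreducible` (row IV-3 (b) of the cell
  `hodgecm-mathlib`; the other half — `End = ℂ` — is the Jacquet-module computation of the sibling files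
  `Zelevinsky1980/*`). Nothing about irreducibility is asserted here.

Point-set instances for `GL_N(F)` (Hausdorff, locally compact, second countable) are proved privately as in
`GLnGelfandKazhdanInvolution` / `InvariantMeasureGLModUnipotentProofs` (not imported).

## References

* [Cartier1979] P. Cartier, *Representations of `p`-adic groups: a survey*, PSPM 33.1 (1979), §III.3.3,
  Thm. 3.2 (c) and formulas (8)–(11), p. 136.
* [BernsteinZelevinsky1977] I. N. Bernstein, A. V. Zelevinsky, Ann. Sci. ÉNS 10 (1977), 1.7–1.9, §2.3.
* [Bump1997] D. Bump, *Automorphic Forms and Representations* (1997), Prop. 4.2.5, Exercise 4.5.6.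
* [Zelevinsky1980] A. V. Zelevinsky, Ann. Sci. ÉNS 13 (1980), §1.1, §3.2, Thm. 4.2.
-/

noncomputable section

open MeasureTheory Measure Set Filter Topology
open scoped NNReal ENNReal ComplexConjugate

namespace Literature.NumberTheory.Automorphic

/-! ### 1. Point-set instances on `GL_N(F)` -/

section GLn

variable (F : Type*) [Field F] [ValuativeRel F] [TopologicalSpace F] [IsNonarchimedeanLocalField F]

/-- `GL_N(F)` is Hausdorff (a theorem to be invoked with `haveI`; copy of the tree's
`t2Space_generalLinearGroup` of `GLnGelfandKazhdanInvolution`, not imported here). [folklore] -/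
private theorem t2Space_glLocalField (N : ℕ) : T2Space (GL (Fin N) F) := by
  haveI : T2Space F := (GaloisRepresentations.IsNonarchimedeanLocalField.isLocalField F).toT2Space
  infer_instance

/-- `GL_N(F)` is locally compact (closed in `M_N(F) × M_N(F)ᵐᵒᵖ`; copy of the tree's
`locallyCompactSpace_generalLinearGroup`). [folklore] -/
private theorem locallyCompactSpace_glLocalField (N : ℕ) : LocallyCompactSpace (GL (Fin N) F) := by
  haveI : T2Space F := (GaloisRepresentations.IsNonarchimedeanLocalField.isLocalField F).toT2Space
  haveI : LocallyCompactSpace (Matrix (Fin N) (Fin N) F) :=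
    inferInstanceAs (LocallyCompactSpace (Fin N → Fin N → F))
  haveI : LocallyCompactSpace (Matrix (Fin N) (Fin N) F)ᵐᵒᵖ :=
    MulOpposite.opHomeomorph.symm.isClosedEmbedding.locallyCompactSpace
  exact Units.isClosedEmbedding_embedProduct.locallyCompactSpace

/-- `GL_N(F)` is second countable (copy of the tree's `secondCountableTopology_gl_localField` of
`InvariantMeasureGLModUnipotentProofs`, not imported here). [folklore] -/
private theorem secondCountableTopology_glLocalField (N : ℕ) :
    SecondCountableTopology (GL (Fin N) F) := by
  haveI := secondCountableTopology_localField F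
  haveI : SecondCountableTopology (Matrix (Fin N) (Fin N) F) :=
    inferInstanceAs (SecondCountableTopology (Fin N → Fin N → F))
  haveI : SecondCountableTopology (Matrix (Fin N) (Fin N) F)ᵐᵒᵖ :=
    MulOpposite.opHomeomorph.symm.secondCountableTopology
  exact Units.isEmbedding_embedProduct.secondCountableTopology

/-! ### 2. The invariant inner product on `i_c(𝟙 ⊗ χ)` and complete reducibility -/

variable {N : ℕ} {α : Type*} [LinearOrder α] [Fintype α] (c : Fin N → α)
  [LocallyCompactSpace (standardParabolicGL F c)]

omit [Fintype α] in
/-- **The equivariance of a function of `i_c(𝟙 ⊗ χ)`**: `f(p x) = δ_{P_c}^{1/2}(p) χ(proj p) f(x)`.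
[cite: BernsteinZelevinsky1977, §2.3] -/
theorem toFun_parabolicIndGL_twist_mul (χ : (Π a, GL {i // c i = a} F) →* ℂˣ)
    (f : Representation.SmoothInd (standardParabolicGL F c)
      (Representation.twist (((Representation.trivial ℂ _ ℂ).twist χ).comp (leviProjection F c))
        (rootDeltaChar (standardParabolicGL F c))))
    (p : standardParabolicGL F c) (x : GL (Fin N) F) :
    f.toFun ((p : GL (Fin N) F) * x) =
      ((rootDeltaChar (standardParabolicGL F c) p : ℂˣ) : ℂ) *
        (((χ (leviProjection F c p) : ℂˣ) : ℂ) * f.toFun x) := by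
  rw [Representation.SmoothInd.toFun_subgroup_mul]
  simp

omit [Fintype α] in
/-- **`conj f₁ · f₂ ∈ Ind(Δ_{P_c})` for `f₁, f₂ ∈ i_c(𝟙 ⊗ χ)` with `χ` unitary**: since
`(δ^{1/2})² = δ = Δ_{P_c}` (the tree's `rootDeltaChar`, Mathlib's `modularCharacter`) and `|χ| = 1`.
[cite: Cartier1979, Thm. 3.2 (c) and (11), p. 136] -/
theorem conj_mul_toFun_parabolicIndGL_mul (χ : (Π a, GL {i // c i = a} F) →* ℂˣ)
    (hχu : ∀ m, ‖((χ m : ℂˣ) : ℂ)‖ = 1)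
    (f₁ f₂ : Representation.SmoothInd (standardParabolicGL F c)
      (Representation.twist (((Representation.trivial ℂ _ ℂ).twist χ).comp (leviProjection F c))
        (rootDeltaChar (standardParabolicGL F c))))
    (p : standardParabolicGL F c) (x : GL (Fin N) F) :
    conj (f₁.toFun ((p : GL (Fin N) F) * x)) * f₂.toFun ((p : GL (Fin N) F) * x) =
      ((modularCharacter p : ℝ≥0) : ℂ) * (conj (f₁.toFun x) * f₂.toFun x) := by
  rw [toFun_parabolicIndGL_twist_mul, toFun_parabolicIndGL_twist_mul, rootDeltaChar_apply]
  set r : ℝ := ((NNReal.sqrt (modularCharacter p) : ℝ≥0) : ℝ) with hr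
  set z : ℂ := ((χ (leviProjection F c p) : ℂˣ) : ℂ) with hz
  have hzz : conj z * z = 1 := by
    rw [mul_comm, Complex.mul_conj, Complex.normSq_eq_norm_sq, hχu]
    simp
  have hrr : (r : ℂ) * (r : ℂ) = ((modularCharacter p : ℝ≥0) : ℝ) := by
    rw [← Complex.ofReal_mul, hr, ← NNReal.coe_mul, NNReal.mul_self_sqrt]
  simp only [map_mul, Complex.conj_ofReal]
  calc (r : ℂ) * (conj z * conj (f₁.toFun x)) * ((r : ℂ) * (z * f₂.toFun x))
        = ((r : ℂ) * (r : ℂ)) * (conj z * z) * (conj (f₁.toFun x) * f₂.toFun x) := by ring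
    _ = ((modularCharacter p : ℝ≥0) : ℝ) * (conj (f₁.toFun x) * f₂.toFun x) := by
        rw [hrr, hzz, mul_one]

/-- **Unitary parabolic induction on `GL_N(F)` is completely reducible.** Let `F` be a
non-archimedean local field, `c : Fin N → α` a block labelling with standard parabolic
`P_c ≤ GL_N(F)`, and `χ` a character of the standard Levi `Π_a GL_{n_a}(F)` which is UNITARY
(`‖χ‖ = 1`) and SMOOTH (open kernel). Then the normalised induced representation
`i_c(𝟙 ⊗ χ) = Ind_{P_c}^{GL_N}(χ ∘ proj ⊗ δ_{P_c}^{1/2})` (`Representation.parabolicIndGL`) is a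
semisimple representation (Mathlib `Representation.IsSemisimpleRepresentation`: every
subrepresentation has an invariant complement). Proof: `⟪f₁, f₂⟫ = ∫_{K₀} conj(f₁) f₂ dμ_{K₀}`
(`K₀` compact open with `GL_N(F) = P_c K₀`, Iwasawa) is a positive definite Hermitian form, and it is
`GL_N(F)`-invariant by the tree's `integral_subgroup_comp_mul_right_eq` applied to
`conj(f₁) f₂ ∈ Ind(Δ_{P_c})` (unimodularity of `GL_N(F)`); an admissible
(`Representation.isAdmissible_parabolicIndGL_holds`, `Liu2021.SplitPlace.isAdmissible_trivial_twist`)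
unitary representation of a group with a
compact open subgroup is completely reducible
(`RepresentationTheory.Unitary.isSemisimpleRepresentation_of_isAdmissible`).
[cite: Cartier1979, Thm. 3.2 (c) with (9)–(11), p. 136] -/
theorem isSemisimpleRepresentation_parabolicIndGL_twist (χ : (Π a, GL {i // c i = a} F) →* ℂˣ)
    (hχu : ∀ m, ‖((χ m : ℂˣ) : ℂ)‖ = 1)
    (hχo : IsOpen ((χ.ker : Subgroup (Π a, GL {i // c i = a} F)) : Set (Π a, GL {i // c i = a} F))) :
    (Representation.parabolicIndGL F c
      ((Representation.trivial ℂ (Π a, GL {i // c i = a} F) ℂ).twist χ)).IsSemisimpleRepresentation := by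
  classical
  -- notation and the point-set / measure-theoretic instances on `G = GL_N(F)`
  set P : Subgroup (GL (Fin N) F) := standardParabolicGL F c with hPdef
  haveI : T2Space (GL (Fin N) F) := t2Space_glLocalField F N
  haveI : LocallyCompactSpace (GL (Fin N) F) := locallyCompactSpace_glLocalField F N
  haveI : SecondCountableTopology (GL (Fin N) F) := secondCountableTopology_glLocalField F N
  letI : MeasurableSpace (GL (Fin N) F) := borel _
  haveI : BorelSpace (GL (Fin N) F) := ⟨rfl⟩
  have hPc : IsClosed (P : Set (GL (Fin N) F)) := isClosed_standardParabolicGL F c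
  -- Iwasawa decomposition `G = P K₀` with `K₀` compact open, and the Haar measures
  obtain ⟨K₀, hK₀c, hK₀o, hPK₀⟩ := exists_isCompact_isOpen_forall_standardParabolicGL_mul F c
  haveI : CompactSpace K₀ := isCompact_iff_compactSpace.1 hK₀c
  set μG : Measure (GL (Fin N) F) := Measure.haar with hμG
  set μK : Measure K₀ := Measure.haar with hμK
  haveI : μG.IsMulRightInvariant := GLn.isMulRightInvariant_of_isHaarMeasure_local N F μG
  -- the representation and the underlying functions
  set σ : Representation ℂ (Π a, GL {i // c i = a} F) ℂ :=
    (Representation.trivial ℂ (Π a, GL {i // c i = a} F) ℂ).twist χ with hσ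
  -- `τ σ' = σ' ∘ proj ⊗ δ^{1/2}`, the representation of `P` that is induced
  let τ : Representation ℂ (Π a, GL {i // c i = a} F) ℂ → Representation ℂ P ℂ := fun σ' =>
    Representation.twist (σ'.comp (leviProjection F c)) (rootDeltaChar P)
  set ρ := Representation.parabolicIndGL F c σ with hρ
  -- continuity and integrability on `K₀` of the functions `k ↦ conj (f₁ k) * f₂ k`
  have hcont : ∀ f : Representation.SmoothInd P (τ σ), Continuous f.toFun := fun f =>
    (Representation.SmoothInd.isLocallyConstant_toFun f).continuous
  have hint : ∀ f₁ f₂ : Representation.SmoothInd P (τ σ),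
      Integrable (fun k : K₀ => conj (f₁.toFun k) * f₂.toFun k) μK := by
    intro f₁ f₂
    have hc : Continuous fun k : K₀ => conj (f₁.toFun k) * f₂.toFun k :=
      ((Complex.continuous_conj.comp ((hcont f₁).comp continuous_subtype_val)).mul
        ((hcont f₂).comp continuous_subtype_val))
    exact hc.integrable_of_hasCompactSupport (HasCompactSupport.of_compactSpace _)
  -- the inner product
  let ip : Representation.SmoothInd P (τ σ) → Representation.SmoothInd P (τ σ) → ℂ :=
    fun f₁ f₂ => ∫ k : K₀, conj (f₁.toFun k) * f₂.toFun k ∂μK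
  have ip_self : ∀ f, ip f f = ((∫ k : K₀, ‖f.toFun k‖ ^ 2 ∂μK : ℝ) : ℂ) := by
    intro f
    show ∫ k : K₀, conj (f.toFun k) * f.toFun k ∂μK = _
    rw [← integral_complex_ofReal]
    refine integral_congr_ae (Eventually.of_forall fun k => ?_)
    show conj (f.toFun k) * f.toFun k = ((‖f.toFun k‖ ^ 2 : ℝ) : ℂ)
    rw [mul_comm, Complex.mul_conj, Complex.normSq_eq_norm_sq, Complex.ofReal_pow]
  let core : InnerProductSpace.Core ℂ (Representation.SmoothInd P (τ σ)) :=
    { inner := ip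
      conj_inner_symm := fun f₁ f₂ => by
        show conj (∫ k : K₀, conj (f₂.toFun k) * f₁.toFun k ∂μK) =
          ∫ k : K₀, conj (f₁.toFun k) * f₂.toFun k ∂μK
        rw [← integral_conj]
        refine integral_congr_ae (Eventually.of_forall fun k => ?_)
        simp [mul_comm]
      re_inner_nonneg := fun f => by
        show 0 ≤ RCLike.re (ip f f)
        rw [ip_self]
        simp only [RCLike.re_to_complex, Complex.ofReal_re]
        exact integral_nonneg fun k => by positivity
      add_left := fun f₁ f₂ f₃ => by
        show ∫ k : K₀, conj ((f₁ + f₂).toFun k) * f₃.toFun k ∂μK =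
          ∫ k : K₀, conj (f₁.toFun k) * f₃.toFun k ∂μK +
            ∫ k : K₀, conj (f₂.toFun k) * f₃.toFun k ∂μK
        rw [← integral_add (hint f₁ f₃) (hint f₂ f₃)]
        refine integral_congr_ae (Eventually.of_forall fun k => ?_)
        simp only [Representation.SmoothInd.toFun_add, Pi.add_apply, map_add, add_mul]
      smul_left := fun f₁ f₂ r => by
        show ∫ k : K₀, conj ((r • f₁).toFun k) * f₂.toFun k ∂μK =
          conj r * ∫ k : K₀, conj (f₁.toFun k) * f₂.toFun k ∂μK
        rw [← integral_const_mul]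
        refine integral_congr_ae (Eventually.of_forall fun k => ?_)
        simp only [Representation.SmoothInd.toFun_smul, Pi.smul_apply, smul_eq_mul, map_mul,
          mul_assoc]
      definite := fun f hf => by
        have h0 : (∫ k : K₀, ‖f.toFun k‖ ^ 2 ∂μK) = 0 := by
          have := ip_self f
          rw [show ip f f = 0 from hf] at this
          exact_mod_cast this.symm
        have hc2 : Continuous fun k : K₀ => ‖f.toFun k‖ ^ 2 :=
          (((hcont f).comp continuous_subtype_val).norm).pow 2
        have hnn : 0 ≤ fun k : K₀ => ‖f.toFun k‖ ^ 2 := fun k => by positivity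
        have hae := (integral_eq_zero_iff_of_nonneg hnn
          (hc2.integrable_of_hasCompactSupport (HasCompactSupport.of_compactSpace _))).1 h0
        have hzero : ∀ k : K₀, f.toFun k = 0 := by
          have heq : (fun k : K₀ => ‖f.toFun k‖ ^ 2) = fun _ => (0 : ℝ) :=
            Continuous.ae_eq_iff_eq μK hc2 continuous_const |>.1 hae
          intro k
          have := congrFun heq k
          simpa using this
        apply Representation.SmoothInd.ext
        funext x
        obtain ⟨p, hp, k, hk, rfl⟩ := hPK₀ x
        rw [Representation.SmoothInd.toFun_zero, Pi.zero_apply,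
          show p * k = ((⟨p, hp⟩ : P) : GL (Fin N) F) * k from rfl,
          Representation.SmoothInd.toFun_subgroup_mul, hzero ⟨k, hk⟩, map_zero] }
  letI : NormedAddCommGroup (Representation.SmoothInd P (τ σ)) :=
    @InnerProductSpace.Core.toNormedAddCommGroup ℂ _ _ _ _ core
  letI : InnerProductSpace ℂ (Representation.SmoothInd P (τ σ)) := InnerProductSpace.ofCore core.toCore
  -- invariance of the inner product
  have hU : ∀ (g : GL (Fin N) F) (f₁ f₂ : Representation.SmoothInd P (τ σ)),
      inner ℂ (ρ g f₁) (ρ g f₂) = inner ℂ f₁ f₂ := by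
    intro g f₁ f₂
    show ∫ k : K₀, conj ((ρ g f₁).toFun k) * (ρ g f₂).toFun k ∂μK =
      ∫ k : K₀, conj (f₁.toFun k) * f₂.toFun k ∂μK
    have h := integral_subgroup_comp_mul_right_eq (H := P) (K := K₀) hPc hK₀o hK₀c hPK₀ μG μK
      (fun x => conj (f₁.toFun x) * f₂.toFun x)
      ((Complex.continuous_conj.comp (hcont f₁)).mul (hcont f₂))
      (fun p x => conj_mul_toFun_parabolicIndGL_mul F c χ hχu f₁ f₂ p x) g
    simpa [hρ, Representation.parabolicIndGL, Representation.toFun_smoothIndRep_apply] using h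
  -- admissibility of `i_c(𝟙 ⊗ χ)` and the conclusion
  have hadm : ρ.IsAdmissible :=
    Representation.isAdmissible_parabolicIndGL_holds F c σ
      (Liu2021.SplitPlace.isAdmissible_trivial_twist χ hχo)
  exact Literature.RepresentationTheory.Unitary.isSemisimpleRepresentation_of_isAdmissible
    (ρ := ρ) ⟨K₀, hK₀o⟩ hK₀c hU hadm

end GLn

/-! ### 3. The inducing datum `(ν₀ ∘ det) ⊠ χ′` of `Q_{N-1,1}` (Zelevinsky 1980, §3.2 / Thm. 4.2) -/

namespace Zelevinsky1980

variable (F : Type*) [Field F] [ValuativeRel F] [TopologicalSpace F] [IsNonarchimedeanLocalField F]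

/-- **`(ν₀ ∘ det_{GL_{N-1}}) × χ′` is completely reducible for unitary continuous `ν₀, χ′`.** For a
non-archimedean local field `F`, `N : ℕ` and UNITARY CONTINUOUS characters `ν₀, χ′ : Fˣ → ℂˣ`, the
normalised induced representation
`parabolicIndGL F (lastBlockLabel N) ((trivial).twist (maxParabolicLeviChar F N ν₀ χ′))` of `GL_N(F)` —
the representation of the named fact `parabolicIndGL_detChar_unitary_isIrreducible` — is semisimple:
`isSemisimpleRepresentation_parabolicIndGL_twist` for the Levi character `(m_a) ↦ ν₀(det m_false) χ′(det m_true)`,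
which is unitary and has open kernel (`Liu2021.SplitPlace.isOpen_ker_maxParabolicLeviChar`,
`isOpen_ker_of_continuous`: no small subgroups in `ℂˣ`). This is the complete-reducibility half of
[Zelevinsky1980, Thm. 4.2] for these data; irreducibility is NOT asserted here.
[cite: Cartier1979, Thm. 3.2 (c) with (9)–(11), p. 136] -/
theorem isSemisimpleRepresentation_parabolicIndGL_detChar (N : ℕ)
    [LocallyCompactSpace (standardParabolicGL F (lastBlockLabel N))]
    (ν₀ χ' : Fˣ →* ℂˣ) (hν₀u : ∀ x, ‖((ν₀ x : ℂˣ) : ℂ)‖ = 1)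
    (hν₀c : Continuous fun x => ((ν₀ x : ℂˣ) : ℂ))
    (hχ'u : ∀ x, ‖((χ' x : ℂˣ) : ℂ)‖ = 1) (hχ'c : Continuous fun x => ((χ' x : ℂˣ) : ℂ)) :
    (Representation.parabolicIndGL F (lastBlockLabel N)
      ((Representation.trivial ℂ (Π a : Bool, GL {i : Fin N // lastBlockLabel N i = a} F) ℂ).twist
        (maxParabolicLeviChar F N ν₀ χ'))).IsSemisimpleRepresentation := by
  refine isSemisimpleRepresentation_parabolicIndGL_twist F (lastBlockLabel N)
    (maxParabolicLeviChar F N ν₀ χ') (fun m => ?_)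
    (Liu2021.SplitPlace.isOpen_ker_maxParabolicLeviChar N ν₀ χ'
      (Liu2021.SplitPlace.isOpen_ker_of_continuous ν₀ hν₀c)
      (Liu2021.SplitPlace.isOpen_ker_of_continuous χ' hχ'c))
  rw [maxParabolicLeviChar_apply, Units.val_mul, norm_mul, hν₀u, hχ'u, mul_one]

end Zelevinsky1980

end Literature.NumberTheory.Automorphic
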